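import Literature.AlgebraicGeometry.Frobenioids.DegreeModelFrobenioid
import Literature.AlgebraicGeometry.Frobenioids.PerfectionProofs
import Literature.AlgebraicGeometry.Frobenioids.PerfectionFunctorialityUnique
import Literature.AlgebraicGeometry.Frobenioids.BaseCategoryTheoreticity
import Mathlib.Algebra.Order.Floor.Defs
import Mathlib.Data.Rat.Floor
import Mathlib.Tactic.Positivity
import HarnessLib

/-!
# Frobenioids I, Theorem 3.4 (iii): the BARE `1`-uniqueness of `Ψ^pf` FAILS — a kernel counterexample

Mochizuki, *The geometry of Frobenioids I: the general theory*, Kyushu J. Math. **62** (2008) 293–400,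
Theorem 3.4 (iii), kurims p. 62 l. 42 – p. 63 l. 2 [cite: MochizukiFrdI2008, Thm. 3.4 (iii) p.62]:
"`Ψ` induces a `1`-unique functor `Ψ^pf : C₁^pf → C₂^pf` that fits into a `1`-commutative diagram
[with the natural functors `C_i → C_i^pf`]"; proof p. 64 ll. 26–28: "follows immediately from the
definition of `C^pf`".

The typed fact `PreFrobenioidData.Thm34iii_pf` (abc-iut-L1-t3, `BaseCategoryTheoreticity.lean`) renders
"`1`-unique" by `PreFrobenioidData.OneUniqueSquare`, whose third conjunct is the BARE uniqueness clause
`∀ B' : C₁^pf ⥤ C₂^pf, (Ψ ⋙ (C₂ → C₂^pf) ≅ (C₁ → C₁^pf) ⋙ B') → Nonempty (B' ≅ Ψ^pf)` — uniqueness among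
ALL functors fitting the square, not only among functors compatible with the Frobenioid structures.
abc-iut-L1-d1 proved it when `C₁` is of perfect type (`Perfection.oneUniqueSquare_map_of_isOfPerfectType`,
slot `FrdI.Thm34Sub.L01p_PfSquareUnique_ofPerfect`); the cell's GAP-LEDGER row G-L1d8-2 recorded the general
case as "truth open (no counterexample)". This file SETTLES it in the negative, kernel-checked:

* `DegreeModel` (file `DegreeModelFrobenioid.lean`) — the model Frobenioid ([FrdI] Thm. 5.2) `C` of the data `(D, Φ, B, Div_B)` =
  (the one-morphism category, the constant divisor monoid `(ℕ, +)`, the zero monoid, `0`): objects are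
  integers `d` ("degrees"), an arrow `d → e` is a pair (Frobenius degree `k ≥ 1`, zero divisor `c ≥ 0`)
  with `e = k·d + c`.  It is a Frobenioid (abc-iut-L1-t2's `ModelFrobenioid.isFrobenioid`), of STANDARD
  type over a base of FSM-type (`isOfStandardType`, via abc-iut-L1-t2's Thm. 5.2 (iii)
  `ModelFrobenioid.standardTypeIff_holds`), and every arrow of `C` is determined by its domain, codomain
  and Frobenius degree (`hom_eq_of_degFr_eq`).
* On THE perfection `C^pf` (abc-iut-L1-d9, `PreFrobenioid.Perfection`) the rational degree
  `q(A, n) := deg(A)/n` satisfies `deg_Fr(f) · q(X) ≤ q(Y)` for every arrow `f : X → Y` (`degFr_mul_q_le`),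
  so the "integer part" `T : C^pf ⥤ C^pf`, `(A, n) ↦ (⌊deg A / n⌋, 1)`, `f ↦` (the arrow of degree
  `deg_Fr(f)`), is a FUNCTOR (`floorFunctor`) with `(C → C^pf) ⋙ T ≅ (C → C^pf)` (`toPfCompFloorIso`) but
  `T(1, 2) = (0, 1) ≇ (1, 2)` (`isEmpty_floor_half_iso`: there is no arrow from rational degree `1/2` to `0`).
* An endofunctor with these two properties kills the bare uniqueness clause for EVERY candidate `Ψ^pf`
  (`PreFrobenioidData.not_oneUniqueSquare_of_endo`, pure category theory: `T ⋙ Ψ^pf` also fits the square,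
  and `Ψ^pf`, an equivalence, reflects `T X ≇ X`).

Conclusions (kernel): `not_oneUniqueSquare_toPf` — no functor `C^pf ⥤ C^pf` whatsoever makes the square
of `Ψ = 𝟭_C` `1`-unique in the bare sense; `not_pfSquareUnique` — d8's slot `L01p_PfSquareUnique_ofPerfect`
is SHARP (its perfect-type hypothesis cannot be dropped); `not_thm34iii_pf` — the typed
`PreFrobenioidData.Thm34iii_pf`, instantiated at THE perfection datum (`PreFrobenioidData.perfection`) of this
standard-type Frobenioid and `Ψ = 𝟭`, is FALSE; `not_isOfPerfectType` — hence `C` is not of perfect type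
(abc-iut-L1-d1's perfect-type theorem is sharp on both sides).  Reading: the typed-literal third conjunct is STRONGER than
what the printed proof establishes; the structure-compatible uniqueness (abc-iut-L1-t3's `PfSquareR` shape)
and the perfect-type case are the faithful readings.  This file refutes a typed READING, not the printed
theorem; no statement of the paper is asserted false.  abc-iut cell, GAP-LEDGER G-L1d8-2 (abc-iut-L1-d4).
-/

noncomputable section

namespace Literature.AlgebraicGeometry.Frobenioids

open CategoryTheory Opposite

/-! ### The abstract obstruction to bare `1`-uniqueness -/

/-- **Obstruction to bare `1`-uniqueness.** If an endofunctor `E` of `Y₁` satisfies `L ⋙ E ≅ L` but moves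
some object (`E P ≇ P`), then NO functor `B : Y₁ ⥤ Y₂` makes the square `(T, L, R, B)` `1`-unique in the
sense of `OneUniqueSquare`: `E ⋙ B` fits the square as well, and an equivalence `B` reflects `E P ≇ P`.
[cite: MochizukiFrdI2008, Thm. 3.4 (iii) p.62] -/
theorem PreFrobenioidData.not_oneUniqueSquare_of_endo {X₁ : Type*} [Category X₁] {X₂ : Type*}
    [Category X₂] {Y₁ : Type*} [Category Y₁] {Y₂ : Type*} [Category Y₂] (T : X₁ ⥤ X₂) (L : X₁ ⥤ Y₁)
    (R : X₂ ⥤ Y₂) (E : Y₁ ⥤ Y₁) (e : L ⋙ E ≅ L) (P : Y₁) (hP : IsEmpty (E.obj P ≅ P)) (B : Y₁ ⥤ Y₂) :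
    ¬ PreFrobenioidData.OneUniqueSquare T L R B := by
  rintro ⟨hB, ⟨i⟩, huniq⟩
  obtain ⟨j⟩ := huniq (E ⋙ B) ⟨i ≪≫ Functor.isoWhiskerRight e.symm B ≪≫ Functor.associator L E B⟩
  exact hP.false (B.preimageIso (j.app P))

/-! ### The degree model and Theorem 3.4 (iii) -/

namespace DegreeModel

/-- Hypothesis (b) of Thm. 3.4 (iii) holds for `Ψ = 𝟭_C`. [cite: MochizukiFrdI2008, Thm. 3.4 (iii) p.62] -/
theorem hypB : PreFrobenioidData.HypB (ModelFrobenioid.data natΦ B DivB) (ModelFrobenioid.data natΦ B DivB)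
    (CategoryTheory.Equivalence.refl (C := C)) :=
  fun _ _ => ⟨fun _ _ _ h => h, fun _ _ _ h => h⟩

/-- The degree of the chosen Frobenius power: `deg(A^{(a)}) = a · deg(A)` (an arrow of Frobenius type has
zero divisor `0`). [cite: MochizukiFrdI2008, Def. 1.3 (ii) p.24] -/
theorem dg_frobPow (A : C) (a : ℕ+) : dg (PreFrobenioid.frobPow hF A a) = (a : ℕ) * dg A := by
  have h := dg_eq (PreFrobenioid.frob hF A a)
  have hd : ModelFrobenioid.degFr (PreFrobenioid.frob hF A a) = a := PreFrobenioid.degFr_frob hF A a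
  have hdiv : dv (PreFrobenioid.frob hF A a) = 1 := (PreFrobenioid.isFrobeniusType_frob hF A a).1.2
  rw [hd, hdiv, toAdd_one, Nat.cast_zero, add_zero] at h
  exact h

/-! ### The perfection and the rational degree -/

/-- THE perfection `C^pf` of `C` (abc-iut-L1-d9). [cite: MochizukiFrdI2008, Def. 3.1 (iii) p.57] -/
abbrev Pf : Type := PreFrobenioid.Perfection hF

open PreFrobenioid.Perfection

/-- The rational degree `q(A, n) := deg(A) / n` of an object of `C^pf` ("`(A, n)` is an `n`-th root of
`A`"). [cite: MochizukiFrdI2008, Def. 3.1 (iii) p.57] -/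
def q (P : Pf) : ℚ := (dg P.obj : ℚ) / ((P.idx : ℕ) : ℚ)

/-- **The rational degree law on `C^pf`**: `deg_Fr(f) · q(X) ≤ q(Y)` for every arrow `f : X → Y` of `C^pf`
(read off a representative `X.obj^{(a)} → Y.obj^{(b)}`, `n_X a = n_Y b`).
[cite: MochizukiFrdI2008, Def. 3.1 (iii) p.57] -/
theorem degFr_mul_q_le {P Q : Pf} (f : P ⟶ Q) : ((Hom.degFr f : ℕ) : ℚ) * q P ≤ q Q := by
  obtain ⟨r, rfl⟩ := Hom.mk_surjective f
  rw [degFr_mk]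
  change ((ModelFrobenioid.degFr r.hom : ℕ) : ℚ) * q P ≤ q Q
  set k : ℕ+ := ModelFrobenioid.degFr r.hom
  have h1 : ((k : ℕ) : ℤ) * ((r.L.a : ℕ) * dg P.obj) ≤ (r.L.b : ℕ) * dg Q.obj := by
    rw [← dg_frobPow P.obj r.L.a, ← dg_frobPow Q.obj r.L.b]
    exact degFr_mul_dg_le r.hom
  have h2 : (P.idx : ℕ) * (r.L.a : ℕ) = (Q.idx : ℕ) * (r.L.b : ℕ) := by
    rw [← PNat.mul_coe, ← PNat.mul_coe, r.L.eq]
  have h1' : ((k : ℕ) : ℚ) * ((r.L.a : ℕ) : ℚ) * (dg P.obj : ℚ) ≤ ((r.L.b : ℕ) : ℚ) * (dg Q.obj : ℚ) := by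
    rw [mul_assoc]; exact_mod_cast h1
  have h2' : ((P.idx : ℕ) : ℚ) * ((r.L.a : ℕ) : ℚ) = ((Q.idx : ℕ) : ℚ) * ((r.L.b : ℕ) : ℚ) := by
    exact_mod_cast h2
  have hP : (0 : ℚ) < ((P.idx : ℕ) : ℚ) := by exact_mod_cast P.idx.pos
  have hQ : (0 : ℚ) < ((Q.idx : ℕ) : ℚ) := by exact_mod_cast Q.idx.pos
  have hb : (0 : ℚ) < ((r.L.b : ℕ) : ℚ) := by exact_mod_cast r.L.b.pos
  unfold q
  rw [mul_div_assoc', div_le_div_iff₀ hP hQ]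
  have key : ((k : ℕ) : ℚ) * (dg P.obj : ℚ) * ((Q.idx : ℕ) : ℚ) * ((r.L.b : ℕ) : ℚ) ≤
      (dg Q.obj : ℚ) * ((P.idx : ℕ) : ℚ) * ((r.L.b : ℕ) : ℚ) :=
    calc ((k : ℕ) : ℚ) * (dg P.obj : ℚ) * ((Q.idx : ℕ) : ℚ) * ((r.L.b : ℕ) : ℚ)
        = ((k : ℕ) : ℚ) * (dg P.obj : ℚ) * (((Q.idx : ℕ) : ℚ) * ((r.L.b : ℕ) : ℚ)) := by ring
      _ = ((k : ℕ) : ℚ) * (dg P.obj : ℚ) * (((P.idx : ℕ) : ℚ) * ((r.L.a : ℕ) : ℚ)) := by rw [h2']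
      _ = ((P.idx : ℕ) : ℚ) * (((k : ℕ) : ℚ) * ((r.L.a : ℕ) : ℚ) * (dg P.obj : ℚ)) := by ring
      _ ≤ ((P.idx : ℕ) : ℚ) * (((r.L.b : ℕ) : ℚ) * (dg Q.obj : ℚ)) :=
          mul_le_mul_of_nonneg_left h1' hP.le
      _ = (dg Q.obj : ℚ) * ((P.idx : ℕ) : ℚ) * ((r.L.b : ℕ) : ℚ) := by ring
  exact le_of_mul_le_mul_right key hb

/-- Integer parts: `deg_Fr(f) · ⌊q(X)⌋ ≤ ⌊q(Y)⌋`. [cite: MochizukiFrdI2008, Def. 3.1 (iii) p.57] -/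
theorem degFr_mul_floor_le {P Q : Pf} (f : P ⟶ Q) : ((Hom.degFr f : ℕ) : ℤ) * ⌊q P⌋ ≤ ⌊q Q⌋ := by
  rw [Int.le_floor]
  push_cast
  calc ((Hom.degFr f : ℕ) : ℚ) * (⌊q P⌋ : ℚ) ≤ ((Hom.degFr f : ℕ) : ℚ) * q P :=
        mul_le_mul_of_nonneg_left (Int.floor_le _) (by positivity)
    _ ≤ q Q := degFr_mul_q_le f

/-! ### The floor endofunctor of `C^pf` -/

/-- The integer part `⌊q P⌋` packaged as the object `(ι ⌊q P⌋, 1)` of `C^pf`. [cite: MochizukiFrdI2008, Def. 3.1 (iii) p.57] -/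
abbrev floorObj (P : Pf) : C := ι ⌊q P⌋

/-- `deg(floorObj P) = ⌊q P⌋`. [cite: MochizukiFrdI2008, Def. 3.1 (iii) p.57] -/
theorem dg_floorObj (P : Pf) : dg (floorObj P) = ⌊q P⌋ := dg_ι _

/-- The arrow of `C` underlying `T f`: `ι⌊q X⌋ → ι⌊q Y⌋` of Frobenius degree `deg_Fr(f)`.
[cite: MochizukiFrdI2008, Def. 3.1 (iii) p.57] -/
def floorHom {P Q : Pf} (f : P ⟶ Q) : floorObj P ⟶ floorObj Q :=
  homOf _ _ (Hom.degFr f) (by rw [dg_floorObj, dg_floorObj]; exact degFr_mul_floor_le f)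

/-- **The floor functor** `T : C^pf ⥤ C^pf`, `(A, n) ↦ (ι⌊deg A / n⌋, 1)`, `f ↦` the image under `C → C^pf`
of the arrow of degree `deg_Fr(f)`; functoriality holds because arrows of `C` are determined by their
Frobenius degree. [cite: MochizukiFrdI2008, Def. 3.1 (iii) p.57] -/
def floorFunctor : Pf ⥤ Pf where
  obj P := (toPf hF).obj (floorObj P)
  map f := (toPf hF).map (floorHom f)
  map_id P := by
    rw [← (toPf hF).map_id]
    congr 1
    apply hom_eq_of_degFr_eq
    rw [floorHom, degFr_homOf, degFr_id']
    rfl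
  map_comp f g := by
    rw [← (toPf hF).map_comp]
    congr 1
    apply hom_eq_of_degFr_eq
    rw [floorHom, degFr_homOf, degFr_comp', ModelFrobenioid.degFr_comp, floorHom, floorHom, degFr_homOf,
      degFr_homOf, mul_comm]

/-- On the image of `C → C^pf` the floor functor is (isomorphic to) the identity: `deg(A)/1` is an integer.
[cite: MochizukiFrdI2008, Def. 3.1 (iii) p.57] -/
theorem dg_floorObj_toPf (A : C) : dg (floorObj ((toPf hF).obj A)) = dg A := by
  rw [dg_floorObj]
  show ⌊(dg A : ℚ) / (((1 : ℕ+) : ℕ) : ℚ)⌋ = dg A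
  rw [PNat.one_coe, Nat.cast_one, div_one, Int.floor_intCast]

/-- **`(C → C^pf) ⋙ T ≅ (C → C^pf)`**: the components are the images of the degree-one isomorphisms
`ι(deg A) ≅ A`; naturality because arrows of `C` are determined by their Frobenius degree.
[cite: MochizukiFrdI2008, Def. 3.1 (iii) p.57] -/
def toPfCompFloorIso : toPf hF ⋙ floorFunctor ≅ toPf hF :=
  NatIso.ofComponents (fun A => (toPf hF).mapIso (isoOf _ _ (dg_floorObj_toPf A))) fun {A A'} φ => by
    change (toPf hF).map (floorHom ((toPf hF).map φ)) ≫ (toPf hF).map _ = (toPf hF).map _ ≫ (toPf hF).map φ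
    rw [← (toPf hF).map_comp, ← (toPf hF).map_comp]
    congr 1
    apply hom_eq_of_degFr_eq
    rw [ModelFrobenioid.degFr_comp, ModelFrobenioid.degFr_comp, floorHom, degFr_homOf, degFr_toPf]
    change 1 * ModelFrobenioid.degFr φ = ModelFrobenioid.degFr φ * 1
    rw [one_mul, mul_one]

/-- The object `(ι 1, 2)` of `C^pf` — "a square root of the object of degree `1`", rational degree `1/2`.
[cite: MochizukiFrdI2008, Def. 3.1 (iii) p.57] -/
def half : Pf := ⟨ι 1, 2⟩

/-- `q(half) = 1/2`. [cite: MochizukiFrdI2008, Def. 3.1 (iii) p.57] -/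
theorem q_half : q half = 1 / 2 := by
  show (dg (ι 1) : ℚ) / (((2 : ℕ+) : ℕ) : ℚ) = 1 / 2
  rw [dg_ι]
  norm_num

/-- `q(T half) = 0`. [cite: MochizukiFrdI2008, Def. 3.1 (iii) p.57] -/
theorem q_floor_half : q (floorFunctor.obj half) = 0 := by
  show (dg (ι ⌊q half⌋) : ℚ) / (((1 : ℕ+) : ℕ) : ℚ) = 0
  rw [dg_ι, q_half]
  norm_num

/-- **`T(half) ≇ half`**: an isomorphism would give an arrow `half → T(half)` of `C^pf`, i.e. from rational
degree `1/2` to rational degree `0`, contradicting `deg_Fr · q(X) ≤ q(Y)`.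
[cite: MochizukiFrdI2008, Def. 3.1 (iii) p.57] -/
theorem isEmpty_floor_half_iso : IsEmpty (floorFunctor.obj half ≅ half) := by
  refine ⟨fun e => ?_⟩
  have h := degFr_mul_q_le e.inv
  rw [q_half, q_floor_half] at h
  have hk : (0 : ℚ) < ((Hom.degFr e.inv : ℕ) : ℚ) := by exact_mod_cast (Hom.degFr e.inv).pos
  linarith

/-! ### Conclusions -/

/-- **No functor `C^pf ⥤ C^pf` makes the perfection square of `Ψ = 𝟭_C` `1`-unique in the bare sense.**
[cite: MochizukiFrdI2008, Thm. 3.4 (iii) p.62] -/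
theorem not_oneUniqueSquare_toPf (Ψpf : Pf ⥤ Pf) :
    ¬ PreFrobenioidData.OneUniqueSquare (𝟭 C) (toPf hF) (toPf hF) Ψpf :=
  PreFrobenioidData.not_oneUniqueSquare_of_endo (𝟭 C) (toPf hF) (toPf hF) floorFunctor toPfCompFloorIso half
    isEmpty_floor_half_iso Ψpf

/-- **The perfect-type hypothesis of `FrdI.Thm34Sub.L01p_PfSquareUnique_ofPerfect` cannot be dropped**:
the unconditional bare `1`-uniqueness of the perfection square fails for the Frobenioid `C` (which is not of
perfect type) and `Ψ = 𝟭_C`. [cite: MochizukiFrdI2008, Thm. 3.4 (iii) p.62] -/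
theorem not_pfSquareUnique :
    ¬ (∀ (hF₁ : PreFrobenioid.IsFrobenioid F) (hF₂ : PreFrobenioid.IsFrobenioid F),
        PreFrobenioid.IsFrobeniusCompatible F F (CategoryTheory.Equivalence.refl (C := C)).functor →
          ∃ Ψpf : PreFrobenioid.Perfection hF₁ ⥤ PreFrobenioid.Perfection hF₂,
            PreFrobenioidData.OneUniqueSquare (CategoryTheory.Equivalence.refl (C := C)).functor
              (PreFrobenioid.Perfection.toPf hF₁) (PreFrobenioid.Perfection.toPf hF₂) Ψpf) := by
  intro h
  obtain ⟨Ψpf, hΨ⟩ := h hF hF ⟨fun _ _ _ hf => hf, fun _ _ _ _ => rfl⟩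
  exact not_oneUniqueSquare_toPf Ψpf hΨ

/-- **`C` is not of perfect type** — read off the obstruction: for a Frobenioid of perfect type the square IS
bare-`1`-unique (abc-iut-L1-d1, `Perfection.oneUniqueSquare_map_of_isOfPerfectType`), so the degree model lies
exactly outside that theorem's hypothesis (directly: `ι 1` has no square root, `deg` being integral).
[cite: MochizukiFrdI2008, Def. 1.2 (iv) p.23] -/
theorem not_isOfPerfectType : ¬ PreFrobenioid.IsOfPerfectType F := fun hP =>
  not_oneUniqueSquare_toPf _
    (PreFrobenioid.Perfection.oneUniqueSquare_map_of_isOfPerfectType (hF₁ := hF) (hF₂ := hF) hP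
      (CategoryTheory.Equivalence.refl (C := C)) ⟨fun _ _ _ hf => hf, fun _ _ _ _ => rfl⟩)

/-- **The typed `PreFrobenioidData.Thm34iii_pf` is FALSE at THE perfection datum** of the standard-type
Frobenioid `C` (one-arrow base, `Φ = ℕ`, `B = 0`) and `Ψ = 𝟭_C`: hypotheses (a) standard type and (b) `HypB`
hold, but no `Ψ^pf` is bare-`1`-unique. The faithful readings (structure-compatible uniqueness; the
perfect-type case `Perfection.oneUniqueSquare_map_of_isOfPerfectType`) are unaffected.
[cite: MochizukiFrdI2008, Thm. 3.4 (iii) p.62] -/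
theorem not_thm34iii_pf :
    ¬ PreFrobenioidData.Thm34iii_pf (ModelFrobenioid.data natΦ B DivB) (ModelFrobenioid.data natΦ B DivB)
        (CategoryTheory.Equivalence.refl (C := C)) (PreFrobenioidData.perfection hF) (PreFrobenioidData.perfection hF) := by
  intro h
  obtain ⟨Ψpf, hΨ, -⟩ := h isOfStandardType isOfStandardType hypB
  exact not_oneUniqueSquare_toPf Ψpf hΨ

end DegreeModel

end Literature.AlgebraicGeometry.Frobenioids

end
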